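import Summits.CriticalPhenomena.PercolationContinuityZ3.Theorems.PercNearOneGluingNoHeavyLowerTailThreeHairKit
import HarnessLib

/-!
# `NoHeavyLowerTail` (stmt-CriticalPhenomena-4575) — the star-monomial reduction of (Y13)

Route `PercNearOneGluingNoHeavy`, crux `NoHeavyLowerTail`; registered stub `stub_sourceRepellerExchangeThreeRelays` (= (Y13),
the source/repeller exchange row `μ(N₂ ∩ {a₂↔o})·(J₁g₃ − J₃g₁) ≤ μ(N₂)·(G₁g₃ − G₃g₁)` of
`…Theorems.preFKG3_of_stubSourceRepellerExchange`; proved for one-layer observers in `…LowerTailOneLayerExchange`).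

This file isolates the purely algebraic part of Kozma–Nitzan's star integration (arXiv:2401.12397, Lemma 5 / proof of Thm. 4,
"summing over all `B`") for an observer `o` whose positive-weight pairs go into an ARBITRARY finite set `A` (`o ∉ A`):
each of the eight measures of (Y13) is the sum over `B ⊆ A` of its slices along the star events `σ_B`
(`KNPreFKG.real_eq_sum_inter_starEvent`), so the (Y13) margin is a triple sum `Σ_{B₁,B₂,B₃ ⊆ A} Φ(B₁,B₂,B₃)` of the
three-copy kernel
  `Φ(B₁,B₂,B₃) = n₂(B₁)·(G₁(B₂)g₃(B₃) − G₃(B₂)g₁(B₃)) − x₂(B₁)·(J₁(B₂)g₃(B₃) − J₃(B₂)g₁(B₃))`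
(slices `n₂(B) = μ(N₂ ∩ σ_B)`, `x₂(B) = μ(N₂ ∩ {a₂↔o} ∩ σ_B)`, …), and by the symmetry of the triple sum it equals one sixth of
the sum of the SYMMETRISED kernel.  Hence (`y13_of_starMonomials`): **if every symmetrised star monomial
`Σ_{π ∈ S₃} Φ(B_{π1},B_{π2},B_{π3})` (`B₁,B₂,B₃ ⊆ A`) is nonnegative, (Y13) holds** — the "star monomial" form of the stub
(RESIDUAL-gen11 §3 of the seat notes: each slice factorises as `μ(σ_B)` times a measure of `G ∖ o` with `B` glued,
`…StarKit.th_real_inter_star`, so the hypothesis is a statement about three independent copies of `G ∖ o`; for `A ⊆ {a₁,a₂,a₃}`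
it is what `…OneLayerExchange` verifies).  No new definition is introduced: the kernel is passed as a function `Φ` together
with its defining equations.
-/

namespace Summit.CriticalPhenomena.PercolationContinuityZ3.Theorems

open MeasureTheory Set Literature.Probability.LatticeModels Literature.Probability.Percolation
open Literature.Probability.Percolation.KNPreFKG

noncomputable section

open Classical

section StarMonomial

variable {V : Type*} [Fintype V]

/-- `(Σᵢ aᵢ)·((Σⱼ bⱼ)(Σₖ cₖ)) = Σᵢ Σⱼ Σₖ aᵢ(bⱼcₖ)` over one finite index set. [folklore] -/
theorem sm_sum_mul_sum_mul_sum {ι : Type*} (s : Finset ι) (a b c : ι → ℝ) :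
    (∑ i ∈ s, a i) * ((∑ j ∈ s, b j) * (∑ k ∈ s, c k)) = ∑ i ∈ s, ∑ j ∈ s, ∑ k ∈ s, a i * (b j * c k) := by
  calc (∑ i ∈ s, a i) * ((∑ j ∈ s, b j) * (∑ k ∈ s, c k))
      = (∑ i ∈ s, a i) * ∑ j ∈ s, ∑ k ∈ s, b j * c k := by rw [Finset.sum_mul_sum]
    _ = ∑ i ∈ s, ∑ j ∈ s, a i * ∑ k ∈ s, b j * c k := by rw [Finset.sum_mul_sum]
    _ = ∑ i ∈ s, ∑ j ∈ s, ∑ k ∈ s, a i * (b j * c k) := by simp only [Finset.mul_sum]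

/-- Symmetrisation of a triple sum over one finite index set: six times the sum of a kernel is the sum of its
symmetrisation. [folklore] -/
theorem sm_sum_symmetrise {ι : Type*} (s : Finset ι) (Φ : ι → ι → ι → ℝ) :
    6 * ∑ i ∈ s, ∑ j ∈ s, ∑ k ∈ s, Φ i j k =
      ∑ i ∈ s, ∑ j ∈ s, ∑ k ∈ s,
        (Φ i j k + Φ i k j + Φ j i k + Φ j k i + Φ k i j + Φ k j i) := by
  have h1 : ∑ i ∈ s, ∑ j ∈ s, ∑ k ∈ s, Φ i k j = ∑ i ∈ s, ∑ j ∈ s, ∑ k ∈ s, Φ i j k :=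
    Finset.sum_congr rfl fun i _ => Finset.sum_comm
  have h2 : ∑ i ∈ s, ∑ j ∈ s, ∑ k ∈ s, Φ j i k = ∑ i ∈ s, ∑ j ∈ s, ∑ k ∈ s, Φ i j k :=
    Finset.sum_comm
  have h3 : ∑ i ∈ s, ∑ j ∈ s, ∑ k ∈ s, Φ j k i = ∑ i ∈ s, ∑ j ∈ s, ∑ k ∈ s, Φ i j k := by
    rw [Finset.sum_comm]
    exact Finset.sum_congr rfl fun j _ => Finset.sum_comm
  have h4 : ∑ i ∈ s, ∑ j ∈ s, ∑ k ∈ s, Φ k i j = ∑ i ∈ s, ∑ j ∈ s, ∑ k ∈ s, Φ i j k := by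
    have : ∑ i ∈ s, ∑ j ∈ s, ∑ k ∈ s, Φ k i j = ∑ i ∈ s, ∑ k ∈ s, ∑ j ∈ s, Φ k i j :=
      Finset.sum_congr rfl fun i _ => Finset.sum_comm
    rw [this, Finset.sum_comm]
  have h5 : ∑ i ∈ s, ∑ j ∈ s, ∑ k ∈ s, Φ k j i = ∑ i ∈ s, ∑ j ∈ s, ∑ k ∈ s, Φ i j k := by
    have : ∑ i ∈ s, ∑ j ∈ s, ∑ k ∈ s, Φ k j i = ∑ i ∈ s, ∑ k ∈ s, ∑ j ∈ s, Φ k j i :=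
      Finset.sum_congr rfl fun i _ => Finset.sum_comm
    rw [this, Finset.sum_comm]
    exact Finset.sum_congr rfl fun k _ => Finset.sum_comm
  simp only [Finset.sum_add_distrib, h1, h2, h3, h4, h5]
  ring

/-- **(Y13) from nonnegative star monomials** (Kozma–Nitzan star integration, arbitrary attachment set).  Let the observer
`o` carry positive weight only on pairs into the finite set `A ∌ o`.  Slicing the eight measures of the source/repeller
exchange row along the star events `σ_B = starEvent o B` (`B ⊆ A`) writes its margin as `Σ_{B₁,B₂,B₃ ⊆ A} Φ(B₁,B₂,B₃)`
with `Φ(B₁,B₂,B₃) = n₂(B₁)(G₁(B₂)g₃(B₃) − G₃(B₂)g₁(B₃)) − x₂(B₁)(J₁(B₂)g₃(B₃) − J₃(B₂)g₁(B₃))` (slices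
`n₂(B) = μ(N₂ ∩ σ_B)`, `x₂(B) = μ(N₂ ∩ {a₂↔o} ∩ σ_B)`, `G₁(B) = μ(R ∩ O ∩ B ∩ σ_B)`, … as in `hΦ`).  If every symmetrised
monomial `Σ_{π∈S₃} Φ(B_π)` is `≥ 0`, then `μ(N₂ ∩ {a₂↔o})(J₁g₃ − J₃g₁) ≤ μ(N₂)(G₁g₃ − G₃g₁)` — the registered stub
`stub_sourceRepellerExchangeThreeRelays` for this `(w, o, b, a₁, a₂, a₃)`.
[cite: KozmaNitzan2024, Lemma 5 and proof of Thm. 4 (pp. 13–14)] -/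
theorem y13_of_starMonomials (w : Sym2 V → unitInterval) (o b a₁ a₂ a₃ : V) (A : Finset V) (ho : o ∉ A)
    (hiso : ∀ u, u ≠ o → u ∉ A → w s(o, u) = 0) (Φ : Finset V → Finset V → Finset V → ℝ)
    (hΦ : ∀ B₁ B₂ B₃,
      Φ B₁ B₂ B₃ =
        (prodBernoulli w).real ((openConn a₂ a₁)ᶜ ∩ (openConn a₂ a₃)ᶜ ∩ starEvent o ↑B₁) *
            ((prodBernoulli w).real ((openConn a₁ a₃)ᶜ ∩ (openConn a₁ o ∩ openConn a₁ b) ∩ starEvent o ↑B₂) *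
                (prodBernoulli w).real ((openConn a₁ a₃)ᶜ ∩ openConn a₃ b ∩ starEvent o ↑B₃) -
              (prodBernoulli w).real ((openConn a₁ a₃)ᶜ ∩ (openConn a₁ o ∩ openConn a₃ b) ∩ starEvent o ↑B₂) *
                (prodBernoulli w).real ((openConn a₁ a₃)ᶜ ∩ openConn a₁ b ∩ starEvent o ↑B₃)) -
          (prodBernoulli w).real ((openConn a₂ a₁)ᶜ ∩ (openConn a₂ a₃)ᶜ ∩ openConn a₂ o ∩ starEvent o ↑B₁) *
            ((prodBernoulli w).real ((openConn a₁ a₃)ᶜ ∩ (openConn a₁ a₂ ∩ openConn a₁ b) ∩ starEvent o ↑B₂) *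
                (prodBernoulli w).real ((openConn a₁ a₃)ᶜ ∩ openConn a₃ b ∩ starEvent o ↑B₃) -
              (prodBernoulli w).real ((openConn a₁ a₃)ᶜ ∩ (openConn a₁ a₂ ∩ openConn a₃ b) ∩ starEvent o ↑B₂) *
                (prodBernoulli w).real ((openConn a₁ a₃)ᶜ ∩ openConn a₁ b ∩ starEvent o ↑B₃)))
    (hpos : ∀ B₁ ∈ A.powerset, ∀ B₂ ∈ A.powerset, ∀ B₃ ∈ A.powerset,
      0 ≤ Φ B₁ B₂ B₃ + Φ B₁ B₃ B₂ + Φ B₂ B₁ B₃ + Φ B₂ B₃ B₁ + Φ B₃ B₁ B₂ + Φ B₃ B₂ B₁) :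
    (prodBernoulli w).real ((openConn a₂ a₁)ᶜ ∩ (openConn a₂ a₃)ᶜ ∩ openConn a₂ o) *
        ((prodBernoulli w).real ((openConn a₁ a₃)ᶜ ∩ (openConn a₁ a₂ ∩ openConn a₁ b)) *
            (prodBernoulli w).real ((openConn a₁ a₃)ᶜ ∩ openConn a₃ b) -
          (prodBernoulli w).real ((openConn a₁ a₃)ᶜ ∩ (openConn a₁ a₂ ∩ openConn a₃ b)) *
            (prodBernoulli w).real ((openConn a₁ a₃)ᶜ ∩ openConn a₁ b)) ≤
      (prodBernoulli w).real ((openConn a₂ a₁)ᶜ ∩ (openConn a₂ a₃)ᶜ) *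
        ((prodBernoulli w).real ((openConn a₁ a₃)ᶜ ∩ (openConn a₁ o ∩ openConn a₁ b)) *
            (prodBernoulli w).real ((openConn a₁ a₃)ᶜ ∩ openConn a₃ b) -
          (prodBernoulli w).real ((openConn a₁ a₃)ᶜ ∩ (openConn a₁ o ∩ openConn a₃ b)) *
            (prodBernoulli w).real ((openConn a₁ a₃)ᶜ ∩ openConn a₁ b)) := by
  set μ := prodBernoulli w with hμ
  set S := A.powerset with hS
  -- the eight slice functions
  set n2 : Finset V → ℝ := fun B => μ.real ((openConn a₂ a₁)ᶜ ∩ (openConn a₂ a₃)ᶜ ∩ starEvent o ↑B) with hn2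
  set x2 : Finset V → ℝ := fun B => μ.real ((openConn a₂ a₁)ᶜ ∩ (openConn a₂ a₃)ᶜ ∩ openConn a₂ o ∩ starEvent o ↑B)
    with hx2
  set G1 : Finset V → ℝ := fun B => μ.real ((openConn a₁ a₃)ᶜ ∩ (openConn a₁ o ∩ openConn a₁ b) ∩ starEvent o ↑B)
    with hG1
  set G3 : Finset V → ℝ := fun B => μ.real ((openConn a₁ a₃)ᶜ ∩ (openConn a₁ o ∩ openConn a₃ b) ∩ starEvent o ↑B)
    with hG3
  set J1 : Finset V → ℝ := fun B => μ.real ((openConn a₁ a₃)ᶜ ∩ (openConn a₁ a₂ ∩ openConn a₁ b) ∩ starEvent o ↑B)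
    with hJ1
  set J3 : Finset V → ℝ := fun B => μ.real ((openConn a₁ a₃)ᶜ ∩ (openConn a₁ a₂ ∩ openConn a₃ b) ∩ starEvent o ↑B)
    with hJ3
  set g1 : Finset V → ℝ := fun B => μ.real ((openConn a₁ a₃)ᶜ ∩ openConn a₁ b ∩ starEvent o ↑B) with hg1
  set g3 : Finset V → ℝ := fun B => μ.real ((openConn a₁ a₃)ᶜ ∩ openConn a₃ b ∩ starEvent o ↑B) with hg3
  -- the eight measures as sums of slices
  have hdec := fun (E : Set (BondConfig V)) => real_eq_sum_inter_starEvent w A o ho hiso E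
  have e_n2 : μ.real ((openConn a₂ a₁)ᶜ ∩ (openConn a₂ a₃)ᶜ) = ∑ B ∈ S, n2 B := hdec _
  have e_x2 : μ.real ((openConn a₂ a₁)ᶜ ∩ (openConn a₂ a₃)ᶜ ∩ openConn a₂ o) = ∑ B ∈ S, x2 B := hdec _
  have e_G1 : μ.real ((openConn a₁ a₃)ᶜ ∩ (openConn a₁ o ∩ openConn a₁ b)) = ∑ B ∈ S, G1 B := hdec _
  have e_G3 : μ.real ((openConn a₁ a₃)ᶜ ∩ (openConn a₁ o ∩ openConn a₃ b)) = ∑ B ∈ S, G3 B := hdec _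
  have e_J1 : μ.real ((openConn a₁ a₃)ᶜ ∩ (openConn a₁ a₂ ∩ openConn a₁ b)) = ∑ B ∈ S, J1 B := hdec _
  have e_J3 : μ.real ((openConn a₁ a₃)ᶜ ∩ (openConn a₁ a₂ ∩ openConn a₃ b)) = ∑ B ∈ S, J3 B := hdec _
  have e_g1 : μ.real ((openConn a₁ a₃)ᶜ ∩ openConn a₁ b) = ∑ B ∈ S, g1 B := hdec _
  have e_g3 : μ.real ((openConn a₁ a₃)ᶜ ∩ openConn a₃ b) = ∑ B ∈ S, g3 B := hdec _
  rw [e_n2, e_x2, e_G1, e_G3, e_J1, e_J3, e_g1, e_g3]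
  -- the kernel in slice form
  have hΦ' : ∀ B₁ B₂ B₃, Φ B₁ B₂ B₃ = n2 B₁ * (G1 B₂ * g3 B₃ - G3 B₂ * g1 B₃) - x2 B₁ * (J1 B₂ * g3 B₃ - J3 B₂ * g1 B₃) :=
    fun B₁ B₂ B₃ => hΦ B₁ B₂ B₃
  -- the margin as a triple sum of the kernel
  have hkey : (∑ B ∈ S, n2 B) * ((∑ B ∈ S, G1 B) * (∑ B ∈ S, g3 B) - (∑ B ∈ S, G3 B) * (∑ B ∈ S, g1 B)) -
      (∑ B ∈ S, x2 B) * ((∑ B ∈ S, J1 B) * (∑ B ∈ S, g3 B) - (∑ B ∈ S, J3 B) * (∑ B ∈ S, g1 B)) =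
      ∑ i ∈ S, ∑ j ∈ S, ∑ k ∈ S, Φ i j k := by
    simp only [hΦ', mul_sub, Finset.sum_sub_distrib]
    rw [← sm_sum_mul_sum_mul_sum S n2 G1 g3, ← sm_sum_mul_sum_mul_sum S n2 G3 g1,
      ← sm_sum_mul_sum_mul_sum S x2 J1 g3, ← sm_sum_mul_sum_mul_sum S x2 J3 g1]
  -- symmetrise and conclude
  have hsym := sm_sum_symmetrise S Φ
  have hnn : 0 ≤ ∑ i ∈ S, ∑ j ∈ S, ∑ k ∈ S, (Φ i j k + Φ i k j + Φ j i k + Φ j k i + Φ k i j + Φ k j i) :=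
    Finset.sum_nonneg fun i hi => Finset.sum_nonneg fun j hj => Finset.sum_nonneg fun k hk => hpos i hi j hj k hk
  have h6 : 0 ≤ ∑ i ∈ S, ∑ j ∈ S, ∑ k ∈ S, Φ i j k := by
    have : 0 ≤ 6 * ∑ i ∈ S, ∑ j ∈ S, ∑ k ∈ S, Φ i j k := by rw [hsym]; exact hnn
    linarith
  rw [← hkey] at h6
  linarith

end StarMonomial

end

end Summit.CriticalPhenomena.PercolationContinuityZ3.Theorems
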